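import Summits.BirchSwinnertonDyer.Rank1Residual.GaloisImage.KuriharaRecordBSDpThreeLevelOne
import Summits.BirchSwinnertonDyer.Rank1Residual.GaloisImage.KolyvaginLevelTwoNineDividesOfBaseRigidity
import Summits.BirchSwinnertonDyer.Rank1Residual.GaloisImage.KuriharaLowerBoundThreeOfKolyvaginProductCyclic
import Summits.BirchSwinnertonDyer.Rank1Residual.GaloisImage.KolyvaginDeepFamily
import HarnessLib

/-!
# R1-61: the END-m2 RECORD COROLLARIES `Assembly.bsdp_three_of_towerSurj_of_levelTwoCertificates`
# — `BSD(E,3)` on a class-A2 row (`#E(ℚ₃)[3] = 3`) from ONE level of the depth-`1` datum with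
# `δ̃_n ≢ 0 (mod 3)` and two level-zero fields, [S24]-FREE
# (cell `b2b-bsdres`, team n1011, ROUTE-1 §33.3 / §35 / §36 sub-target R1-61; OWNERS row T-E2-REC;
# seat p18; lead R5-70 ADDENDUM 1 (d))

HONEST FRAMING (cell `b2b-bsdres`, run/shared/lean/b2b/bsd-rank1-residual/, verbatim in every
file): the goal of the cell is to DELETE the COMBINATION-SHAPED residual classes of the
Birch–Swinnerton-Dyer formula for ALL analytic-rank `≤ 1` elliptic curves over `ℚ` — "full BSD
formula for every rank `≤ 1` curve in class `C`" assembled STRICTLY from published theorems — so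
that the rank-`≤ 1` remainder becomes exactly the CONSTRUCTION-SHAPED classes, which are TYPED
(missing-input `Prop`s), NOT attempted. This is not "finishing BSD". Team n1011 (N10/N11, the
additive block `X4 ∧ p = 3`): research route; PER-PAIR record shape, NOT a class theorem; TOOL
theorems only (no definition, no named fact); nothing booked; no mark / label moved.  END-m2 is
WEAKER than the S24-DEEP pair END (`BSD(E,3)` only where `ord₃(L(E,1)/Ω_E) ≤ 2`) — DEBT REDUCTION
on class A2, not coverage: CONDITIONAL on the UPPER-half facts of the X4 chain of record
(`hKatoS hDel hmodD hKatoχ`; `hGZK hmod h26`), Cassels–Tate (`hCT`), the Poitou–Tate family at `3`,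
Tate's `hEP`, and the ONE port `KatoKuriharaPortThreeAt W 1 v₃` (FLAG `K22-Thm3.13-PORT@3`,
construction-shaped, NOT in print at `3`) — and on NO [S24] fact of any level: the injectivity at
the core vertex `∅` is n1011-p11's BASE RIGIDITY read on the deep-class datum by n1011-p15
(`kolyvaginSystem_eq_zero_of_apply_empty_eq_zero_of_baseRigidity_deep`, F-E1), consumed through
p15's `exists_ne_zero_mem_selmerGroup_three_of_dictionaryTwo_of_levelTwo_certificate_of_baseRigidity`
(F-E2).  The certificate lines are per-record EVIDENCE; the `3`-adic tower (mod-`27` surjectivity in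
particular) is a VISIBLE input of every END-m2 record (r1 ROUTE-1 §35.3).

## What and why (r1 ROUTE-1 §33.3 A2 analogue, §35.2–35.6, §36; lead R5-70 ADDENDUM 1 (d))

n1011-p15's END-m2 (`KolyvaginLevelTwoNineDivides[OfBaseRigidity]`, T-INJ-DEV F-D / F-E2): on an
additive `3 ∤ c₃`, surj(3), `#E(ℚ₃)[3] = 3` (t = 1) row, the depth-`1` dictionary
`KatoKuriharaDictionaryThreeAt W 1 1 D₉ v₃` + `3 · [0]⁺ ≡ 0 (mod 9)` + ONE level `n` of `D₉` with
`3 · δ̃_n ≠ 0` in `ℤ/9` give `Sel₃(E) ≠ 0` (DATUM-GENERIC: a datum `D₉` on `E[9]` and its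
`E[3]`-companion `D₃` with the same primes, pinned to Sakamoto's class through `E[3^{k′+1}]`).
THIS file is the RECORD SIDE, the `m = 2` twin of `KuriharaRecordBSDpThreeLevelOneEndOfBaseRigidity`
(p292786):

* `Assembly.exists_ne_zero_mem_selmerGroup_three_of_port_of_kolyvaginProduct_levelTwo_of_baseRigidity`
  — `Sel₃(E) ≠ 0` in RECORD currency: the datum is built INSIDE from the `3`-adic tower (ONE `τ` for
  all levels, n1011-p15's `S24Deep.exists_tau_forall_levels_of_towerSurj`; `D₉` on `E[9]` with primes
  THE `27`-class `frobeniusClassPrimes (E[27]) S(T) τ 27` — (B6): on `t = 1` rows the Kolyvagin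
  primes of depth `1` live in `𝒫_{1+1+t} = 𝒫₃` — by p15's
  `S24Deep.exists_eta_kolyvaginDatum_torsion_pow_mul_deep`, and `D₃` on `E[3]` with the SAME primes and
  the SAME primitive roots by `S24Deep.exists_kolyvaginDatum_hasCanonicalComparison_frobeniusClassPrimes_deep`;
  `T = {v ∣ 3} ∪ {bad}` by `TowerPackage.towerAdmissible`); the dictionary is PINNED from the ONE
  port by this seat's `dictionaryThreeAt_one_one_of_port` (p293667; guard `IsCanonicalTauDatumThreeAt
  W (1+1) 1`); the certificate level `n ∈ 𝒩₃(E,3)` (Kim: square-free, `ℓ ∤ 3N`, `ℓ ≡ 1 (27)`,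
  `27 ∣ #Ẽ(𝔽_ℓ)`) with the records' cyclicity flag becomes a level of `D₉`
  (`FrobShape.exists_level_of_kolyvaginProduct` at `K = 3`, mod-`27` surjectivity).
* `Assembly.bsdp_three_of_towerSurj_of_levelTwoCertificates_of_baseRigidity` — `BSD(E,3)` on a
  potentially good, unit-Tamagawa class-A2 row: binders = the END-m1 record corollary's
  (`bsdp_three_of_towerSurj_of_levelOneCertificates_of_baseRigidity`) with `ht0 ↦ ht1`, the port at
  `t = 1`, the certificate one depth up (`n ∈ 𝒩₃`, `ψ` onto `ℤ/9`, `3·δ̃_n ≠ 0` and `3·δ̃_1 = 0` in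
  `ℤ/9`), and the SAME level-zero field `δ̃_1 ≢ 0 (mod 27)`; LOWER: `Sel₃ ≠ 0` ⟹ (rank `0`, `hCT`)
  `9 ∣ #Ш(E)[3^∞]` (`sq_dvd_card_sha_three_of_exists_selmer_ne_zero`) ⟹ the socket
  `bsdp_three_of_towerSurj_of_sq_dvd_card_sha` (the level-zero witness `ord₃(L/Ω) ≤ 2` never used `t`).
* `Assembly.bsdp_three_potMult_of_levelTwoCertificates_of_baseRigidity` — the (M) rows
  (`ord₃ j < 0`; UPPER through additive-p1's `ω`-branch socket; the tower is STILL a binder, now for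
  the LOWER side).

HONEST LIMITS (r1 §35.6 / §36): debt reduction on class A2 (`t = 1`; 29 T-UNIT rows of the census),
not coverage; the depth-`2` certificate level is `27`-admissible at every prime and NO engine value
exists today (no pilot record in this file); a record needs mod-`27` surjectivity (a tower instance)
and a two-source unit at `(row, n)`.

References: C.-H. Kim, AJM 148 (2026) Thm. 1.9 (6), Thm. 3.13 [Kim2022StructureSelmer]; B. Mazur,
K. Rubin, Mem. AMS 799 (2004) Thm. 3.2.4, §3.5 (H.5) [MazurRubin2004]; R. Sakamoto, JTNB 36 (2024) §2,
Def. 4.1, Cor. 5.5 [Sakamoto2024]; K. Rubin, PCMI 18 (2011) Thm. 2.8.4, Cor. 2.8.9 [Rubin2011];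
K. Kato, Astérisque 295 (2004) Thm. 14.5 (3) [Kato2004Asterisque]; A. Agashe, K. Ribet, W. Stein
(2006) Thm. 2.6 [AgasheRibetStein2006]; J. H. Silverman, AEC (2009) X.4.2, X.4.14 [SilvermanAEC2009];
R. L. Miller, LMS JCM 14 (2011) Def. 1.1 [Miller2011LMS].
-/

noncomputable section

open scoped Classical NumberField ContRepresentation
open Function Field NumberField IsDedekindDomain IsDedekindDomain.HeightOneSpectrum WeierstrassCurve
  CongruenceSubgroup
  Literature.NumberTheory.EllipticCurves Literature.NumberTheory.EllipticCurves.ModularForms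
  Literature.NumberTheory.EllipticCurves.Rank1Residual
  Literature.NumberTheory.EllipticCurves.AgasheRibetStein2006
  Literature.NumberTheory.GaloisRepresentations
  Literature.NumberTheory.GaloisRepresentations.DiscreteGaloisModule Literature.NumberTheory.GaloisCohomology
  Rat.HeightOneSpectrum
  Summit.BirchSwinnertonDyer.Rank1Residual.Additive Summit.BirchSwinnertonDyer.Rank1Residual.X4
open Literature.NumberTheory.DiophantineGeometry.Dioph (ratModP)

namespace Summit.BirchSwinnertonDyer.Rank1Residual.GaloisImage.Assembly

/-! ### The depth-one datum behind the port: `Sel₃(E) ≠ 0` in record currency -/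

/-- **`Sel₃(E) ≠ 0` on a class-A2 row from ONE depth-one Kurihara non-vanishing, in RECORD currency —
[S24]-FREE (base rigidity).**  `W/ℚ` globally minimal, additive at `3` with `3 ∤ c₃`, the `3`-adic
tower `ρ_{E,3^m}` onto for all `m`, `#E(ℚ₃)[3] = 3`; the Poitou–Tate family at `3` (three properties),
Tate's `hEP`, the ONE port `KatoKuriharaPortThreeAt W 1 v₃`, a parametrisation datum `D` with
`3 ∤ c_D` and the unit period transfer; `3 · δ̃_1 = 0` in `ℤ/9` (`3 ∣ [0]⁺`); and ONE `n ∈ 𝒩₃(E,3)`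
(square-free product of primes `ℓ ∤ 3N`, `ℓ ≡ 1 (mod 27)`, `a_ℓ ≡ ℓ + 1 (mod 27)`) with the cyclicity
flag `#(E₀ mod ℓ)(𝔽_ℓ)[3] ≤ 3` at its primes, `ψ` onto `ℤ/9` at its primes, and `3 · δ̃_n(ψ) ≠ 0` in
`ℤ/9` (`δ̃_n` a `3`-adic unit).  THEN `Sel^(3)(E/ℚ) ≠ 0` — n1011-p15's END-m2
`exists_ne_zero_mem_selmerGroup_three_of_dictionaryTwo_of_levelTwo_certificate_of_baseRigidity` fed
with: ONE `τ` for all levels from the tower; `D₉` on `E[9]` with primes the `27`-class of `τ` off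
`S(T)`, `T = {v ∣ 3} ∪ {bad}`, cyclotomic transverse conditions, THE canonical comparison maps at `9`;
`D₃` on `E[3]` with the same primes and primitive roots, canonical at `3`; the dictionary
`KatoKuriharaDictionaryThreeAt W 1 1 D₉ v₃` PINNED from the port (`dictionaryThreeAt_one_one_of_port`);
the level of `n` in the `27`-class (`FrobShape.exists_level_of_kolyvaginProduct`, `K = 3`).  NO [S24]
fact anywhere in the dependence cone; the tower is used on THIS (lower) side.
[cite: Kim2022StructureSelmer, Thm. 3.13 and §1.2.2] [cite: Sakamoto2024, §2 (pp. 920–921) and Def. 4.1]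
[cite: Rubin2011, Thm. 2.8.4 and Cor. 2.8.9 (pp. 25–26)] -/
theorem exists_ne_zero_mem_selmerGroup_three_of_port_of_kolyvaginProduct_levelTwo_of_baseRigidity
    (W : WeierstrassCurve ℚ) [W.IsElliptic] [W.IsGloballyMinimal]
    (hadd : haveI : Fact (Nat.Prime 3) := ⟨Nat.prime_three⟩; Addv W 3)
    (hc3 : ¬ 3 ∣ (W.baseChange ℚ_[3]).localTamagawaNumber ℤ_[3])
    (htower : ∀ m : ℕ, W.HasSurjectiveModNGaloisRep (3 ^ m : ℕ))
    (ht1 : Nat.card {Q : (W.baseChange ℚ_[3]).toAffine.Point // (3 : ℕ) • Q = 0} = 3 ^ 1)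
    {N : ℕ} [NeZero N] (D : ModularParametrizationData W N)
    (hcP : ¬ ((3 : ℕ) : ℤ) ∣ D.maninConstant)
    (hper : ∃ u : ℚ, ‖(u : ℚ_[3])‖ = 1 ∧ W.realPeriodRat = u * plusPeriod D.f)
    (inv : LocalInvariants ℚ 3) (hperf : inv.IsPerfect) (hsum : inv.SumLocalTermEqZero)
    (hcompl : inv.SelmerComplement)
    (hEP : ∀ v : HeightOneSpectrum (𝓞 ℚ), localEulerPoincareCharacteristic (v.adicCompletion ℚ))
    (v₃ : HeightOneSpectrum (𝓞 ℚ)) (hv₃ : ((3 : ℕ) : 𝓞 ℚ) ∈ v₃.asIdeal)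
    (hPort : KatoKuriharaPortThreeAt W 1 v₃)
    (n : ℕ) [NeZero n] (hn : Kato.IsKolyvaginProduct W 3 3 n)
    (hcyc : ∀ (ℓ : ℕ) [Fact ℓ.Prime], ℓ ∣ n →
      Nat.card {P : ((integralModelInt W).map (Int.castRingHom (ZMod ℓ))).toAffine.Point //
        3 • P = 0} ≤ 3)
    (ψ : (ℓ : ℕ) → (ZMod ℓ)ˣ →* Multiplicative (ZMod (3 ^ 2)))
    (hψ : ∀ ℓ ∈ n.primeFactors, Function.Surjective (ψ ℓ))
    (hcert : (3 : ZMod (3 ^ 2)) * kuriharaNumber D.f (3 ^ 2) n ψ ≠ 0)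
    (hzero₉ : (3 : ZMod (3 ^ 2)) * kuriharaNumber D.f (3 ^ 2) 1 ψ = 0) :
    ∃ x ∈ (W.kummerSelmerStructure ((3 : ℕ) : ℤ)).selmerGroup, x ≠ 0 := by
  haveI : Fact (Nat.Prime 3) := ⟨Nat.prime_three⟩
  -- the admissible set `T = {v ∣ 3} ∪ {bad}`, `S = S(T)`; `E[3]` finite
  obtain ⟨T, h3T, hbadT, hTmem, -, -, -, hfinT, -⟩ := TowerPackage.towerAdmissible W
  haveI : Finite (geomTorsion W ((3 : ℕ) : ℤ)) := hfinT 0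
  have h3S : ∀ v : HeightOneSpectrum (𝓞 ℚ), ((3 : ℕ) : 𝓞 ℚ) ∈ v.asIdeal →
      (Sum.inr v : Place ℚ) ∈ finSupport T := fun v hv => (inr_mem_finSupport_iff T v).mpr (h3T v hv)
  have hbadS : ∀ v : HeightOneSpectrum (𝓞 ℚ), ¬ W.HasGoodReductionAt v →
      (Sum.inr v : Place ℚ) ∈ finSupport T := fun v hv => (inr_mem_finSupport_iff T v).mpr (hbadT v hv)
  have hSgood : ∀ v ∉ {v : HeightOneSpectrum (𝓞 ℚ) | (Sum.inr v : Place ℚ) ∈ finSupport T},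
      W.HasGoodReductionAt v ∧ ((3 : ℕ) : 𝓞 ℚ) ∉ v.asIdeal := fun v hv =>
    ⟨by_contra fun h => hv (hbadS v h), fun h => hv (h3S v h)⟩
  -- surjectivity mod `3` and mod `27` from the tower
  have hsurj : W.HasSurjectiveModNGaloisRep ((3 : ℕ) : ℤ) := by simpa using htower 1
  have hsurj27 : W.HasSurjectiveModNGaloisRep (((3 : ℕ) : ℤ) ^ 2 * ((3 : ℕ) : ℤ)) := by
    have h := htower 3
    norm_num at h ⊢
    exact h
  -- ONE `τ` for all levels: `τ ∈ Gal(ℚ̄/ℚ(μ_{3^n}))`, `E[3^{m+1}]/(τ − 1) ≅ ℤ/3^{m+1}`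
  obtain ⟨τ, hτμ, hτq⟩ := S24Deep.exists_tau_forall_levels_of_towerSurj W htower
  have hτμ27 : τ ∈ rootsOfUnityFixer ℚ (3 ^ (2 + 1)) := hτμ (2 + 1)
  have hτq27 : Nonempty (cokerSubOne (W.torsionGaloisModule (((3 : ℕ) : ℤ) ^ 2 * ((3 : ℕ) : ℤ))) τ ≃+
      ZMod (3 ^ (2 + 1))) := hτq 2
  have hτq9 : Nonempty (cokerSubOne (W.torsionGaloisModule (((3 : ℕ) : ℤ) ^ 1 * ((3 : ℕ) : ℤ))) τ ≃+
      ZMod (3 ^ (1 + 1))) := hτq 1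
  have hτq3 : Nonempty (cokerSubOne (W.torsionGaloisModule ((3 : ℕ) : ℤ)) τ ≃+ ZMod 3) := hτq 0
  -- the deep datum `D₉` on `E[9]` with primes THE `27`-class, and its `E[3]`-companion `D₃`
  obtain ⟨η, D₉, hP₉, hT₉, hD₉⟩ := S24Deep.exists_eta_kolyvaginDatum_torsion_pow_mul_deep W
    (k := 1) (k' := 2) (by norm_num) {v | (Sum.inr v : Place ℚ) ∈ finSupport T} hτμ27 hτq9
  have hker : ∀ u : absoluteGaloisGroup ℚ,
      W.torsionGaloisModule (((3 : ℕ) : ℤ) ^ 2 * ((3 : ℕ) : ℤ)) u = 1 →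
        W.torsionGaloisModule ((3 : ℕ) : ℤ) u = 1 :=
    fun u hu => S24Deep.torsionGaloisModule_eq_one_of_dvd W (Dvd.intro_left _ rfl) u hu
  have hη : ∀ q ∈ frobeniusClassPrimes (W.torsionGaloisModule (((3 : ℕ) : ℤ) ^ 2 * ((3 : ℕ) : ℤ)))
      {v | (Sum.inr v : Place ℚ) ∈ finSupport T} τ (3 ^ (2 + 1)), Subgroup.zpowers (η q) = ⊤ :=
    fun q hq => hD₉.zpowers_eq_top (by rw [hP₉]; exact hq)
  obtain ⟨D₃, hP₃, hT₃, hD₃⟩ :=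
    S24Deep.exists_kolyvaginDatum_hasCanonicalComparison_frobeniusClassPrimes_deep
      (W.torsionGaloisModule ((3 : ℕ) : ℤ)) (W.torsionGaloisModule (((3 : ℕ) : ℤ) ^ 2 * ((3 : ℕ) : ℤ)))
      3 (3 ^ (2 + 1)) hker (dvd_pow_self 3 (Nat.succ_ne_zero 2))
      {v | (Sum.inr v : Place ℚ) ∈ finSupport T} hτμ27 hτq3
      (cyclotomicTransverse (W.torsionGaloisModule ((3 : ℕ) : ℤ))) η hη
  have hP : D₃.primes = D₉.primes := hP₃.trans hP₉.symm
  -- the dictionary at `(k, t) = (1, 1)` PINNED from the ONE port (guard: primes in the `27`-class)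
  have hDict : KatoKuriharaDictionaryThreeAt W 1 1 D₉ v₃ :=
    dictionaryThreeAt_one_one_of_port W hPort hSgood hτμ27 hτq27 hP₉ hT₉ hD₉
  -- the level of `n` in the `27`-class (Kim's `𝒩₃` + the cyclicity flag ⟹ Sakamoto's class)
  have hflag : ∀ v : HeightOneSpectrum (𝓞 ℚ), Ideal.absNorm v.asIdeal ∣ n →
      Nat.card (AddSubgroup.torsionBy (W.reductionAt v).toAffine.Point (3 : ℕ)) ≤ 3 :=
    fun v hv => natCard_torsionBy_reductionAt_le_of_dvd W 3 hcyc hv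
  have hnS : ∀ v : HeightOneSpectrum (𝓞 ℚ), Ideal.absNorm v.asIdeal ∣ n →
      v ∉ {v : HeightOneSpectrum (𝓞 ℚ) | (Sum.inr v : Place ℚ) ∈ finSupport T} := by
    intro v hv hvS
    obtain ⟨hgood, h3v⟩ := hasGoodReductionAt_and_not_mem_of_kolyvaginProduct W 3 hn hv
    rcases hTmem v ((inr_mem_finSupport_iff T v).mp hvS) with h | h
    · exact h hgood
    · exact h3v h
  have hτμ27' : τ ∈ rootsOfUnityFixer ℚ (3 ^ 3) := hτμ 3
  have hτq27' : Nonempty (cokerSubOne (W.torsionGaloisModule (((3 : ℕ) : ℤ) ^ 2 * ((3 : ℕ) : ℤ))) τ ≃+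
      ZMod (3 ^ 3)) := hτq 2
  obtain ⟨nF, hnF, hprod, hmem⟩ := FrobShape.exists_level_of_kolyvaginProduct W 3 (K := 3)
    (by norm_num) hn hflag (((3 : ℕ) : ℤ) ^ 2 * ((3 : ℕ) : ℤ)) (by norm_num) hsurj27 hτμ27' hτq27' hnS
  have hlevel : D₉.IsLevel nF := by
    show (↑nF : Set (HeightOneSpectrum (𝓞 ℚ))) ⊆ D₉.primes
    rw [hP₉]
    exact hnF
  -- the certificate at the level `nF`, and `3 · [0]⁺ = 0` in `ℤ/9`
  have hψ₀ : ∀ q ∈ nF, Function.Surjective (ψ (Ideal.absNorm q.asIdeal)) :=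
    fun q hq => hψ _ (hmem q hq)
  have hcert' : ∀ (m : ℕ) (inst : NeZero m), m = n →
      (3 : ZMod (3 ^ (1 + 1))) * @kuriharaNumber _ D.f (3 ^ (1 + 1)) m inst ψ ≠ 0 := by
    rintro m inst rfl
    exact hcert
  have hzero : (3 : ZMod (3 ^ (1 + 1))) * ratModP (3 ^ (1 + 1)) (ratPlusSymbol D.f 0) = 0 := by
    have h := hzero₉
    rw [kuriharaNumber_one] at h
    exact h
  exact exists_ne_zero_mem_selmerGroup_three_of_dictionaryTwo_of_levelTwo_certificate_of_baseRigidity W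
    hsurj inv hperf hsum hcompl hEP (finSupport T) (inl_mem_finSupport T) h3S hbadS (k' := 2)
    (by norm_num) hτμ27 hτq9 hτq3 D₉ D₃ hP hP₉ hT₉ hT₃ hD₉ hD₃ v₃ hv₃ hDict hadd hc3 ht1 D hcP hper
    hzero nF hlevel hψ₀ (hcert' _ _ hprod)

/-! ### The END-m2 record corollaries -/

/-- **END-m2, RECORD COROLLARY (r1 ROUTE-1 §33.3 / §36, R1-61): `BSD(E,3)` on a class-A2 row from
ONE depth-one Kurihara non-vanishing and two level-zero fields — [S24]-FREE form.**  `W/ℚ` globally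
minimal with integral model `E₀` ADDITIVE at `3` (`3 ∣ Δ`, `3 ∣ c₄`), the `3`-adic tower (UPPER side
AND the lower datum: mod-`27` surjectivity is a visible input of every END-m2 record), `#E(ℚ₃)[3] = 3`,
analytic rank `0`, `3 ∤ ∏ c_ℓ`, an OPTIMAL datum at `N ≤ 130000`; the UPPER-half facts of the X4
chain of record; NO [S24] fact of any level (injectivity at `∅` = base rigidity on the deep-class
datum, n1011-p15 F-E1 over n1011-p11 R1-58), NO `inv′` family; Cassels–Tate; the Poitou–Tate family
at `3` (`hperf hsum hcompl`), Tate's `hEP`; ONE port `KatoKuriharaPortThreeAt W 1 v₃`; and the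
CERTIFICATE: ONE `n ∈ 𝒩₃(E,3)` (any number of primes; `ℓ ≡ 1 (27)`, `27 ∣ #Ẽ(𝔽_ℓ)`) with the
cyclicity flag `#(E₀ mod ℓ)(𝔽_ℓ)[3] ≤ 3` at its primes, `ψ` onto `ℤ/9`, `3 · δ̃_n(ψ) ≠ 0` in `ℤ/9`,
and the two level-zero fields `3 · δ̃_1 = 0` in `ℤ/9` (`3 ∣ [0]⁺`), `δ̃_1 ≢ 0 (mod 27)`.  THEN
`BSD(E, 3)`.  Binders = the END-m1 record corollary
`bsdp_three_of_towerSurj_of_levelOneCertificates_of_baseRigidity`'s with `ht0 ↦ ht1`, the port at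
`t = 1`, and the certificate one depth up — nothing else.  (Lower half: p15's END-m2 ⟹ `Sel₃ ≠ 0`
⟹ `9 ∣ #Ш(3)`; `27 ∤ [0]⁺` ⟹ `ord₃(L/Ω) ≤ 2 ≤ ord₃ #Ш(3)`; UPPER: additive-p4's socket.)
[cite: Kim2022StructureSelmer, Thm. 1.9 (6) and Thm. 3.13] [cite: Rubin2011, Thm. 2.8.4 and Cor. 2.8.9]
[cite: Kato2004Asterisque, Thm. 14.5 (3) (p. 236)] [cite: AgasheRibetStein2006, Thm. 2.6 (p. 619)]
[cite: SilvermanAEC2009, Thm. X.4.2 (a) and X.4.14] -/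
theorem bsdp_three_of_towerSurj_of_levelTwoCertificates_of_baseRigidity
    (hKatoS : Kato2004.rankZero_padicValNat_sha_le_sub_localTamagawa_of_additive_potGood_of_imageContainsSL2)
    (hDel : Delbourgo1998.prop4_rankZero_pow_dvd_constantCoeff)
    (hGZK : rank_eq_analyticRank_of_analyticRank_le_one) (hmod : hasEntireLFunction_rat)
    (hmodD : nonempty_modularParametrizationData)
    (hKatoχ : Wuthrich2014.kato_halfEigenCharIdeal_dvd_cyclotomicPrime_of_surjective)
    (h26 : cremona_abs_maninConstant_eq_one_of_level_le)
    (hCT : exists_casselsTate_pairing (K := ℚ))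
    (W : WeierstrassCurve ℚ) [W.IsElliptic] [W.IsGloballyMinimal]
    -- the row
    {E₀ : WeierstrassCurve ℤ} (hI : integralModelInt W = E₀)
    (hΔ : (3 : ℤ) ∣ E₀.Δ) (hc₄ : (3 : ℤ) ∣ E₀.c₄)
    (htower : ∀ m : ℕ, W.HasSurjectiveModNGaloisRep (3 ^ m : ℕ))
    (ht1 : Nat.card {Q : (W.baseChange ℚ_[3]).toAffine.Point // (3 : ℕ) • Q = 0} = 3 ^ 1)
    (hr : W.analyticRank = 0) (htam : ¬ 3 ∣ W.tamagawaProduct)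
    {N : ℕ} [NeZero N] (hN : N ≤ 130000) (D : ModularParametrizationData W N)
    (hopt : ∀ z ∈ D.L.lattice, ∃ w ∈ periodLattice D.f, z = D.c * w)
    -- the Poitou–Tate family at `3`, Tate's local Euler characteristic, ONE port
    (inv : LocalInvariants ℚ 3) (hperf : inv.IsPerfect) (hsum : inv.SumLocalTermEqZero)
    (hcompl : inv.SelmerComplement)
    (hEP : ∀ v : HeightOneSpectrum (𝓞 ℚ), localEulerPoincareCharacteristic (v.adicCompletion ℚ))
    (v₃ : HeightOneSpectrum (𝓞 ℚ)) (hv₃ : ((3 : ℕ) : 𝓞 ℚ) ∈ v₃.asIdeal)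
    (hPort : KatoKuriharaPortThreeAt W 1 v₃)
    -- the certificate: ONE depth-one non-vanishing, two level-zero fields
    (n : ℕ) [NeZero n] (hn : Kato.IsKolyvaginProduct W 3 3 n)
    (hcyc : ∀ (ℓ : ℕ) [Fact ℓ.Prime], ℓ ∣ n →
      Nat.card {P : ((integralModelInt W).map (Int.castRingHom (ZMod ℓ))).toAffine.Point //
        3 • P = 0} ≤ 3)
    (ψ : (ℓ : ℕ) → (ZMod ℓ)ˣ →* Multiplicative (ZMod (3 ^ 2)))
    (hψ : ∀ ℓ ∈ n.primeFactors, Function.Surjective (ψ ℓ))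
    (hcert : (3 : ZMod (3 ^ 2)) * kuriharaNumber D.f (3 ^ 2) n ψ ≠ 0)
    (hzero₉ : (3 : ZMod (3 ^ 2)) * kuriharaNumber D.f (3 ^ 2) 1 ψ = 0)
    (ψ₂₇ : (ℓ : ℕ) → (ZMod ℓ)ˣ →* Multiplicative (ZMod (3 ^ 3)))
    (hunit₁ : kuriharaNumber D.f (3 ^ 3) 1 ψ₂₇ ≠ 0) :
    BSDp W 3 := by
  haveI : Fact (Nat.Prime 3) := ⟨Nat.prime_three⟩
  have hadd : Addv W 3 := addv_of_intModel hI 3 (by exact_mod_cast hΔ) (by exact_mod_cast hc₄)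
  have hc3 : ¬ 3 ∣ (W.baseChange ℚ_[3]).localTamagawaNumber ℤ_[3] := fun h =>
    htam (h.trans (localTamagawaNumber_padic_dvd_tamagawaProduct W 3))
  have hsurj' : W.HasSurjectiveModNGaloisRep 3 := by simpa using htower 1
  -- rank `0`: `E(ℚ)`, `Ш` finite; `E[3]` irreducible
  have hGZ := hGZK W (by rw [hr]; exact zero_le_one)
  haveI : Finite W.sha := hGZ.2
  haveI : Finite W.toAffine.Point := W.mordellWeilRank_eq_zero_iff_holds.mp (by rw [hGZ.1, hr])
  have hirr : W.HasIrreducibleModPGaloisRep 3 :=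
    hasIrreducibleModPGaloisRep_of_hasSurjectiveModNGaloisRep W 3 hsurj'
  -- the optimal datum: `3 ∤ c_D`, the period transfer
  have hcD : ¬ (3 : ℤ) ∣ D.maninConstant :=
    not_dvd_maninConstant_of_level_le h26 W D hopt hN Nat.prime_three
  have hper : ∃ u : ℚ, ‖(u : ℚ_[3])‖ = 1 ∧ W.realPeriodRat = u * plusPeriod D.f :=
    periodTransfer_of_optimal 3 D hopt hcD
  have hcP : ¬ ((3 : ℕ) : ℤ) ∣ D.maninConstant := by exact_mod_cast hcD
  -- LOWER: Sel₃ ≠ 0 (END-m2) ⟹ 9 ∣ #Ш(3); then the socket with the level-zero witness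
  have hSel :=
    exists_ne_zero_mem_selmerGroup_three_of_port_of_kolyvaginProduct_levelTwo_of_baseRigidity W hadd
      hc3 htower ht1 D hcP hper inv hperf hsum hcompl hEP v₃ hv₃ hPort n hn hcyc ψ hψ hcert hzero₉
  have h9 := sq_dvd_card_sha_three_of_exists_selmer_ne_zero hCT W hirr hSel
  exact bsdp_three_of_towerSurj_of_sq_dvd_card_sha hKatoS hDel hGZK hmod hmodD hKatoχ h26 W hI hΔ hc₄
    htower hr htam hN D hopt h9 ψ₂₇ hunit₁

/-- **END-m2, RECORD COROLLARY on the potentially MULTIPLICATIVE class-A2 rows (`ord₃ j < 0`) —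
[S24]-FREE form.**  As `bsdp_three_of_towerSurj_of_levelTwoCertificates_of_baseRigidity` with the
UPPER half through additive-p1's `ω`-branch socket: NO Tamagawa hypothesis beyond `3 ∤ c₃`, NO Manin
bound on the UPPER side (`ord₃ j < 0` instead); the `3`-adic tower STAYS a binder — the LOWER datum of
END-m2 needs ONE `τ` at the levels `3, 9, 27` and the level of `n` in the `27`-class (r1 §35.3: on
END-m2 rows mod-`27` surjectivity is a visible input, (M) rows included).
[cite: Kim2022StructureSelmer, Thm. 1.9 (6) and Thm. 3.13] [cite: Rubin2011, Thm. 2.8.4 and Cor. 2.8.9]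
[cite: Delbourgo1998, Prop. 4 (p. 144)] [cite: AgasheRibetStein2006, Thm. 2.6 (p. 619)]
[cite: SilvermanAEC2009, Thm. X.4.2 (a) and X.4.14] -/
theorem bsdp_three_potMult_of_levelTwoCertificates_of_baseRigidity
    (hKatoS : Kato2004.rankZero_padicValNat_sha_le_sub_localTamagawa_of_additive_potGood_of_imageContainsSL2)
    (hDel : Delbourgo1998.prop4_rankZero_pow_dvd_constantCoeff)
    (hGZK : rank_eq_analyticRank_of_analyticRank_le_one) (hmod : hasEntireLFunction_rat)
    (hmodD : nonempty_modularParametrizationData)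
    (hKatoχ : Wuthrich2014.kato_halfEigenCharIdeal_dvd_cyclotomicPrime_of_surjective)
    (h26 : cremona_abs_maninConstant_eq_one_of_level_le)
    (hCT : exists_casselsTate_pairing (K := ℚ))
    (W : WeierstrassCurve ℚ) [W.IsElliptic] [W.IsGloballyMinimal]
    {E₀ : WeierstrassCurve ℤ} (hI : integralModelInt W = E₀)
    (hΔ : (3 : ℤ) ∣ E₀.Δ) (hc₄ : (3 : ℤ) ∣ E₀.c₄)
    (htower : ∀ m : ℕ, W.HasSurjectiveModNGaloisRep (3 ^ m : ℕ)) (hjneg : padicValRat 3 W.j < 0)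
    (hc3 : ¬ 3 ∣ (W.baseChange ℚ_[3]).localTamagawaNumber ℤ_[3])
    (ht1 : Nat.card {Q : (W.baseChange ℚ_[3]).toAffine.Point // (3 : ℕ) • Q = 0} = 3 ^ 1)
    (hr : W.analyticRank = 0)
    {N : ℕ} [NeZero N] (hN : N ≤ 130000) (D : ModularParametrizationData W N)
    (hopt : ∀ z ∈ D.L.lattice, ∃ w ∈ periodLattice D.f, z = D.c * w)
    (inv : LocalInvariants ℚ 3) (hperf : inv.IsPerfect) (hsum : inv.SumLocalTermEqZero)
    (hcompl : inv.SelmerComplement)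
    (hEP : ∀ v : HeightOneSpectrum (𝓞 ℚ), localEulerPoincareCharacteristic (v.adicCompletion ℚ))
    (v₃ : HeightOneSpectrum (𝓞 ℚ)) (hv₃ : ((3 : ℕ) : 𝓞 ℚ) ∈ v₃.asIdeal)
    (hPort : KatoKuriharaPortThreeAt W 1 v₃)
    (n : ℕ) [NeZero n] (hn : Kato.IsKolyvaginProduct W 3 3 n)
    (hcyc : ∀ (ℓ : ℕ) [Fact ℓ.Prime], ℓ ∣ n →
      Nat.card {P : ((integralModelInt W).map (Int.castRingHom (ZMod ℓ))).toAffine.Point //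
        3 • P = 0} ≤ 3)
    (ψ : (ℓ : ℕ) → (ZMod ℓ)ˣ →* Multiplicative (ZMod (3 ^ 2)))
    (hψ : ∀ ℓ ∈ n.primeFactors, Function.Surjective (ψ ℓ))
    (hcert : (3 : ZMod (3 ^ 2)) * kuriharaNumber D.f (3 ^ 2) n ψ ≠ 0)
    (hzero₉ : (3 : ZMod (3 ^ 2)) * kuriharaNumber D.f (3 ^ 2) 1 ψ = 0)
    (ψ₂₇ : (ℓ : ℕ) → (ZMod ℓ)ˣ →* Multiplicative (ZMod (3 ^ 3)))
    (hunit₁ : kuriharaNumber D.f (3 ^ 3) 1 ψ₂₇ ≠ 0) :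
    BSDp W 3 := by
  haveI : Fact (Nat.Prime 3) := ⟨Nat.prime_three⟩
  have hadd : Addv W 3 := addv_of_intModel hI 3 (by exact_mod_cast hΔ) (by exact_mod_cast hc₄)
  have hsurj' : W.HasSurjectiveModNGaloisRep 3 := by simpa using htower 1
  have hGZ := hGZK W (by rw [hr]; exact zero_le_one)
  haveI : Finite W.sha := hGZ.2
  haveI : Finite W.toAffine.Point := W.mordellWeilRank_eq_zero_iff_holds.mp (by rw [hGZ.1, hr])
  have hirr : W.HasIrreducibleModPGaloisRep 3 :=
    hasIrreducibleModPGaloisRep_of_hasSurjectiveModNGaloisRep W 3 hsurj'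
  have hcD : ¬ (3 : ℤ) ∣ D.maninConstant :=
    not_dvd_maninConstant_of_level_le h26 W D hopt hN Nat.prime_three
  have hper : ∃ u : ℚ, ‖(u : ℚ_[3])‖ = 1 ∧ W.realPeriodRat = u * plusPeriod D.f :=
    periodTransfer_of_optimal 3 D hopt hcD
  have hcP : ¬ ((3 : ℕ) : ℤ) ∣ D.maninConstant := by exact_mod_cast hcD
  have hSel :=
    exists_ne_zero_mem_selmerGroup_three_of_port_of_kolyvaginProduct_levelTwo_of_baseRigidity W hadd
      hc3 htower ht1 D hcP hper inv hperf hsum hcompl hEP v₃ hv₃ hPort n hn hcyc ψ hψ hcert hzero₉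
  have h9 := sq_dvd_card_sha_three_of_exists_selmer_ne_zero hCT W hirr hSel
  exact bsdp_three_potMult_of_sq_dvd_card_sha hKatoS hDel hGZK hmod hmodD hKatoχ h26 W hI hΔ hc₄ hsurj'
    hjneg hr hN D hopt h9 ψ₂₇ hunit₁

end Summit.BirchSwinnertonDyer.Rank1Residual.GaloisImage.Assembly

end
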